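import Summits.CriticalPhenomena.SAWScalingLimit.Theses.SAWLoopFugacityFlow
import Literature.Probability.RandomPlanarGeometry.RectangleConformalMap
import Literature.Probability.RandomPlanarGeometry.CaratheodoryHalfPlaneProofs
import Literature.Probability.RandomPlanarGeometry.HullSubdomainPullback
import Literature.Probability.RandomPlanarGeometry.SAWScalingLimitFamily
import Literature.Probability.RandomPlanarGeometry.JordanDomainProofs

/-!
# Negative knowledge on crux `AvoidanceLimit`, part 1: the witness domains

Support file (refuter / cdisprove lane) for the crux
`Summit.CriticalPhenomena.SAWScalingLimit.Theses.SAWLoopFugacityFlow.AvoidanceLimit`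
(stmt-CriticalPhenomena-10649, route SAWLoopFugacityFlow, rank 2): for every Dobrushin domain
`(D; a, b)`, hull subdomain `D'`, endpoint approximation, chordal uniformizer `φ`, pulled-back hull
`A = closure (ℍ ∖ φ⁻¹ D')` and restriction data `(Φ, d = Φ'_A(0))`,
`P_δ(range γ_δ ⊆ closure D') → d^(5/8)` as `δ → 0+`. The crux itself is NOT refuted (it follows from
`SAWScalingLimit`; LSW04 Prediction 1 on avoidance marginals); the `Negative/` files record, as
kernel-checked theorems, which hypotheses any proof MUST use: each variant is the crux with ONE
hypothesis dropped or weakened, everything else verbatim, and each is FALSE.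

This part builds the witnesses shared by parts 2–5: the square `(-2,2)²` marked at the side
midpoints `2`, `-2` (`bigSq`, on the tree's `rectDomain`), its re-marking `topSq` at `1 + 2i`,
`-1 + 2i` on the top side (same carrier, definitionally), and the strip `flatRect = (-2,2) × (-1,1)`
marked at `2`, `-2` — a hull subdomain of `bigSq` (`flatRect_subset`, `flatRect_ball_agree`) whose
closure misses the marked points of `topSq` (`topSq_pt_notMem_closure`) — plus three small shared
helpers (`limit_unique`, `one_ne_zero_rpow`, `empty_eq_pullback_self`). [folklore]
-/

noncomputable section

open Set Filter Topology MeasureTheory Complex Metric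
open UpperHalfPlane (upperHalfPlaneSet isOpen_upperHalfPlaneSet)
open Literature.Probability.RandomPlanarGeometry Literature.Probability.LatticeModels
open Summit.CriticalPhenomena.SAWScalingLimit.Theses.SAWLoopFugacityFlow (AvoidanceLimit)

namespace Summit.CriticalPhenomena.SAWScalingLimit.Theorems.AvoidanceLimit.Negative

/-! ### The witnesses: a square marked at two side midpoints, re-marked on its top side, and a strip -/

/-- The open square `(-2, 2)²` as a Jordan domain (tree: `rectDomain`). [folklore] -/
def sq : JordanDomain := rectDomain 2 2 two_pos two_pos

/-- The square `(-2,2)²` marked at the midpoints `2` and `-2` of its vertical sides. [folklore] -/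
def bigSq : DobrushinDomain where
  toJordanDomain := sq
  mark := ![3 / 8, 7 / 8]
  strictMono_mark := Fin.strictMono_iff_lt_succ.2 fun i ↦ by fin_cases i; simp; norm_num
  mark_mem i := by fin_cases i <;> simp <;> norm_num

/-- The same square, re-marked at the points `1 + 2i` and `-1 + 2i` of its TOP side (same carrier as
`bigSq`, definitionally). [folklore] -/
def topSq : DobrushinDomain where
  toJordanDomain := sq
  mark := ![9 / 16, 11 / 16]
  strictMono_mark := Fin.strictMono_iff_lt_succ.2 fun i ↦ by fin_cases i; simp; norm_num
  mark_mem i := by fin_cases i <;> simp <;> norm_num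

/-- The strip `(-2, 2) × (-1, 1)` marked at `2` and `-2`: a hull subdomain of `bigSq`. [folklore] -/
def flatRect : DobrushinDomain where
  toJordanDomain := rectDomain 2 1 two_pos one_pos
  mark := ![3 / 8, 7 / 8]
  strictMono_mark := Fin.strictMono_iff_lt_succ.2 fun i ↦ by fin_cases i; simp; norm_num
  mark_mem i := by fin_cases i <;> simp <;> norm_num

/-- The carrier of `bigSq` is the open square (by definition). [folklore] -/
theorem bigSq_carrier : bigSq.carrier = symRect 2 2 := rfl
/-- The carrier of `topSq` is the same open square (by definition). [folklore] -/
theorem topSq_carrier : topSq.carrier = symRect 2 2 := rfl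
/-- The carrier of `flatRect` is the open strip (by definition). [folklore] -/
theorem flatRect_carrier : flatRect.carrier = symRect 2 1 := rfl

/-- Evaluation of the square's boundary loop at a parameter `(k + θ)/4`. [folklore] -/
theorem loop_eval {a b : ℝ} {t : ℝ} (k : ℕ) (hk : k < 4) (θ : ℝ) (hθ : θ ∈ Icc (0:ℝ) 1)
    (ht : t = ((k : ℝ) + θ) / 4) :
    polygonLoop (rectVerts a b) t =
      AffineMap.lineMap ((rectVerts a b)[k]'(by simpa using hk))
        ((rectVerts a b)[(k + 1) % 4]'(by simp; omega)) θ := by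
  have h := polygonLoop_apply_div (l := rectVerts a b) (k := k) (by simpa using hk) hθ
  simp only [length_rectVerts, Nat.cast_ofNat] at h
  rw [ht, h]

/-- First marked point of `bigSq`: the midpoint `2` of the right side. [folklore] -/
theorem bigSq_pt_zero : bigSq.pt 0 = (2 : ℂ) := by
  show polygonLoop (rectVerts 2 2) (3 / 8 : ℝ) = 2
  rw [loop_eval 1 (by norm_num) (1 / 2) (by norm_num) (by norm_num)]
  apply Complex.ext <;> norm_num [rectVerts, AffineMap.lineMap_apply_module']

/-- Second marked point of `bigSq`: the midpoint `-2` of the left side. [folklore] -/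
theorem bigSq_pt_one : bigSq.pt 1 = (-2 : ℂ) := by
  show polygonLoop (rectVerts 2 2) (7 / 8 : ℝ) = -2
  rw [loop_eval 3 (by norm_num) (1 / 2) (by norm_num) (by norm_num)]
  apply Complex.ext <;> norm_num [rectVerts, AffineMap.lineMap_apply_module']

/-- First marked point of `flatRect`: `2`. [folklore] -/
theorem flatRect_pt_zero : flatRect.pt 0 = (2 : ℂ) := by
  show polygonLoop (rectVerts 2 1) (3 / 8 : ℝ) = 2
  rw [loop_eval 1 (by norm_num) (1 / 2) (by norm_num) (by norm_num)]
  apply Complex.ext <;> norm_num [rectVerts, AffineMap.lineMap_apply_module']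

/-- Second marked point of `flatRect`: `-2`. [folklore] -/
theorem flatRect_pt_one : flatRect.pt 1 = (-2 : ℂ) := by
  show polygonLoop (rectVerts 2 1) (7 / 8 : ℝ) = -2
  rw [loop_eval 3 (by norm_num) (1 / 2) (by norm_num) (by norm_num)]
  apply Complex.ext <;> norm_num [rectVerts, AffineMap.lineMap_apply_module']

/-- First marked point of `topSq`: `1 + 2i` on the top side. [folklore] -/
theorem topSq_pt_zero : topSq.pt 0 = (1 : ℂ) + 2 * I := by
  show polygonLoop (rectVerts 2 2) (9 / 16 : ℝ) = 1 + 2 * I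
  rw [loop_eval 2 (by norm_num) (1 / 4) (by norm_num) (by norm_num)]
  apply Complex.ext <;> norm_num [rectVerts, AffineMap.lineMap_apply_module']

/-- Second marked point of `topSq`: `-1 + 2i` on the top side. [folklore] -/
theorem topSq_pt_one : topSq.pt 1 = (-1 : ℂ) + 2 * I := by
  show polygonLoop (rectVerts 2 2) (11 / 16 : ℝ) = -1 + 2 * I
  rw [loop_eval 2 (by norm_num) (3 / 4) (by norm_num) (by norm_num)]
  apply Complex.ext <;> norm_num [rectVerts, AffineMap.lineMap_apply_module']

/-- The strip lies in the square. [folklore] -/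
theorem flatRect_subset : flatRect.carrier ⊆ bigSq.carrier := by
  intro z hz
  rw [flatRect_carrier, mem_symRect] at hz
  rw [bigSq_carrier, mem_symRect]
  exact ⟨hz.1, by linarith [hz.2.1], by linarith [hz.2.2]⟩

/-- Near the marked points `±2` the strip and the square agree (balls of radius `1`). [folklore] -/
theorem flatRect_ball_agree (c : ℂ) (hc : c.im = 0) :
    flatRect.carrier ∩ ball c 1 = bigSq.carrier ∩ ball c 1 := by
  ext z
  simp only [mem_inter_iff, Metric.mem_ball, flatRect_carrier, bigSq_carrier, mem_symRect]
  constructor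
  · rintro ⟨⟨hre, him⟩, hd⟩
    exact ⟨⟨hre, by linarith [him.1], by linarith [him.2]⟩, hd⟩
  · rintro ⟨⟨hre, -⟩, hd⟩
    have h1 : |(z - c).im| ≤ ‖z - c‖ := Complex.abs_im_le_norm _
    rw [Complex.sub_im, hc, sub_zero] at h1
    rw [dist_eq_norm] at hd
    have h2 := (abs_lt.1 (lt_of_le_of_lt h1 hd))
    exact ⟨⟨hre, h2.1, h2.2⟩, by rwa [dist_eq_norm]⟩

/-- The re-marked points of `topSq` are off the closed strip. [folklore] -/
theorem topSq_pt_notMem_closure (i : Fin 2) : topSq.pt i ∉ closure flatRect.carrier := by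
  rw [flatRect_carrier, closure_symRect two_pos one_pos, mem_reProdIm]
  fin_cases i
  · simp [topSq_pt_zero]
  · simp [topSq_pt_one]

/-! ### Shared helpers -/

/-- Two limits of one function along `𝓝[>] 0` force `ofReal (d₁^(5/8)) = ofReal (d₂^(5/8))`. -/
theorem limit_unique {F : ℝ → ENNReal} {d₁ d₂ : ℝ}
    (h₁ : Tendsto F (𝓝[>] 0) (𝓝 (ENNReal.ofReal (d₁ ^ ((5 : ℝ) / 8)))))
    (h₂ : Tendsto F (𝓝[>] 0) (𝓝 (ENNReal.ofReal (d₂ ^ ((5 : ℝ) / 8))))) :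
    ENNReal.ofReal (d₁ ^ ((5 : ℝ) / 8)) = ENNReal.ofReal (d₂ ^ ((5 : ℝ) / 8)) :=
  tendsto_nhds_unique h₁ h₂

/-- `ofReal (1^(5/8)) ≠ ofReal (0^(5/8))` in `ℝ≥0∞`. [folklore] -/
theorem one_ne_zero_rpow :
    ENNReal.ofReal ((1 : ℝ) ^ ((5 : ℝ) / 8)) ≠ ENNReal.ofReal ((0 : ℝ) ^ ((5 : ℝ) / 8)) := by
  rw [Real.one_rpow, Real.zero_rpow (by norm_num), ENNReal.ofReal_one, ENNReal.ofReal_zero]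
  exact one_ne_zero

/-- The empty pulled-back hull: for `D' = D`, `closure (ℍ ∖ φ⁻¹ D) = ∅`. [folklore] -/
theorem empty_eq_pullback_self {D : DobrushinDomain} (φ : ConformalEquiv upperHalfPlaneSet D.carrier) :
    (∅ : Set ℂ) = closure (upperHalfPlaneSet \ {z | z ∈ upperHalfPlaneSet ∧ φ z ∈ D.carrier}) := by
  rw [eq_comm, closure_empty_iff, Set.sdiff_eq_empty]
  exact fun z hz ↦ ⟨hz, φ.mapsTo hz⟩

end Summit.CriticalPhenomena.SAWScalingLimit.Theorems.AvoidanceLimit.Negative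

end
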